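import Literature.RepresentationTheory.CompactGroups.AbelianCharacterSeparation
import Literature.RepresentationTheory.CompactGroups.IsotypicProjection
import HarnessLib

/-!
# Completeness of the isotypic decomposition of a Banach representation of a compact abelian group

Topic `RepresentationTheory/CompactGroups`; namespace `Literature.RepresentationTheory.CompactGroups.AbelianIsotypic`
(+ two corollaries in `…CompactGroups.Isotypic`).  Proof file: theorems only, no definition, no named fact, no `sorry`.

Bröcker–tom Dieck, *Representations of Compact Lie Groups* (GTM 98, 1985), Ch. III, Theorem (5.10) (iii): a unitary
representation `H` of a compact group is the Hilbert sum of its isotypic parts `H_χ`; in particular a vector all of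
whose isotypic components vanish is `0`.  The tree's `IsotypicProjection` proves (5.10) (i), (iv) for ONE-DIMENSIONAL
characters (the averaging operator `Isotypic.proj μ ω χ v = ∫ χ(k) • ω(k) v dμ` IS the projection onto the
`χ̄`-isotypic subspace) and lists the completeness statement (iii) under "Not here".  This file proves it for compact
ABELIAN groups — where every irreducible character is one-dimensional, so that (i) + (iii) is the whole theorem — in
the generality of a strongly continuous representation `ρ : K →* (E →L[ℂ] E)` on a complex BANACH space, and detects
isotypic components through continuous linear FUNCTIONALS (the form theta lifts use):

* `AbelianIsotypic.exists_character_apply_average_ne_zero` — **a continuous linear functional `Λ` with `Λ v ≠ 0` is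
  non-zero on some average `∫ χ(k) • ρ(k) v dμ(k)`**, `χ : K →ₜ* S¹` a continuous unitary character: the continuous
  function `k ↦ Λ (ρ k v)` on `K` is `≠ 0` at `k = 1`, so by the Pontryagin–van Kampen theorem PROVED in the tree
  (`AbelianCharacterSeparation.exists_integral_mul_character_ne_zero`: a non-zero continuous function on a compact
  abelian group has a non-zero Fourier coefficient) `∫ Λ(ρ k v) χ(k) dμ ≠ 0` for some `χ`, and the functional passes
  under the Bochner integral (`ContinuousLinearMap.integral_comp_comm`);
* `AbelianIsotypic.exists_character_average_ne_zero` — **a non-zero vector has a non-zero average against some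
  character** (Hahn–Banach, `exists_dual_vector`, + the previous item);
* `AbelianIsotypic.apply_average` — the average is `χ̄`-isotypic: `ρ g (∫ χ • ρ v) = conj χ(g) • ∫ χ • ρ v` for a
  left-invariant `μ` (Bröcker–tom Dieck III Lemma (5.5), as `Isotypic.apply_proj` but for bounded operators);
  `AbelianIsotypic.eq_zero_of_forall_average_eq_zero` — completeness: all averages zero ⇒ `v = 0`;
* `Isotypic.exists_proj_ne_zero` / `Isotypic.eq_zero_of_forall_proj_eq_zero` — the same for the tree's
  `Isotypic.proj μ ω χ` of a strongly continuous UNITARY representation `ω : K →* (E ≃ₗᵢ[ℂ] E)` on a Hilbert (complete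
  inner-product) space: **Bröcker–tom Dieck III (5.10) (iii) for compact abelian `K`**;
* `AbelianIsotypic.mem_closure_span_range_average` / `AbelianIsotypic.topologicalClosure_span_range_average_eq_top` —
  the BANACH form of (iii): every `v` lies in the closure of the span of its own averages `∫ χ • ρ v dμ` (Hahn–Banach on
  the seminormed quotient `E ⧸ span`, `exists_dual_vector`, + `exists_character_apply_average_ne_zero`), so the
  averages span a dense subspace of `E`;
* `Isotypic.orthogonal_iSup_isoSub_eq_bot` / `Isotypic.topologicalClosure_iSup_isoSub_eq_top` /
  `Isotypic.mem_closure_iSup_isoSub` — the Hilbert-space form of (iii): for `μ` a left- and inversion-invariant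
  probability measure charging open sets (normalised Haar) the isotypic subspaces `isoSub ω χ` span a DENSE subspace,
  `(⨆_χ isoSub ω χ)ᗮ = ⊥` and `(⨆_χ isoSub ω χ).topologicalClosure = ⊤` (self-adjointness and idempotence of the
  averages, tree `Isotypic.inner_proj_comm` / `proj_proj`, give `‖P_χ w‖² = ⟪P_χ w, w⟫`, `Isotypic.inner_proj_self_eq`).

Typing: `K` a compact Hausdorff abelian topological group with a Borel σ-algebra, `μ` a finite Borel measure charging
open sets (left-invariant where stated; the normalised Haar measure qualifies), `E` a complex Banach space,
`hρ : ∀ v, Continuous fun k => ρ k v` strong continuity — exactly the hypotheses under which the integrands are Bochner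
integrable, so no statement holds by a junk value of `∫`.

## Mathlib / tree
Mathlib: Bochner integral, `ContinuousLinearMap.integral_comp_comm`, `integral_mul_left_eq_self`, Hahn–Banach
`exists_dual_vector`, `PontryaginDual`; no isotypic decomposition for compact groups.  Tree: `IsotypicProjection`
((5.10) (i), (iv), one-dimensional `χ`), `AbelianCharacterSeparation` (Pontryagin–van Kampen, compact case),
`CircleWeightSpaces` (FINITE-dimensional `U(1)`-modules are the direct sum of their weight spaces — the
finite-dimensional circle case of the present completeness).  `lean search 'exists_proj_ne_zero|forall_average|AbelianIsotypic'`: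
no hit outside this file.

## References
* T. Bröcker, T. tom Dieck, *Representations of Compact Lie Groups*, GTM 98 (1985), III (5.1), (5.5), (5.10) [BrockerTomDieck1985].
* A. Deitmar, S. Echterhoff, *Principles of Harmonic Analysis*, 2nd ed. (2014), Prop. 3.5.2 (Pontryagin–van Kampen)
  [DeitmarEchterhoff2014].

## Provenance
Lane `lit-hodgefound` (HOME `run/shared/lean/pub/lit-hodgefound/`), prover seat `lit-hodgefound-p05` generation 5, second
row: the functional-analytic engine behind "theta lifts with a prescribed character"
(`GelbartRogawski1991/UnitaryDualPairThetaLiftGaussianCharacter`).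
-/

set_option autoImplicit false

noncomputable section

open MeasureTheory Complex ComplexConjugate

namespace Literature.RepresentationTheory.CompactGroups

namespace AbelianIsotypic

variable {K : Type*} [CommGroup K] [TopologicalSpace K] [IsTopologicalGroup K] [CompactSpace K] [T2Space K]
  [MeasurableSpace K] [BorelSpace K]
variable {E : Type*} [NormedAddCommGroup E] [NormedSpace ℂ E] [CompleteSpace E]
variable (μ : Measure K) [IsFiniteMeasure μ] [μ.IsOpenPosMeasure]
variable (ρ : K →* (E →L[ℂ] E)) (hρ : ∀ v, Continuous fun k => ρ k v)

omit [IsTopologicalGroup K] [CompactSpace K] [T2Space K] [MeasurableSpace K] [BorelSpace K] in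
/-- `χ(k⁻¹) = conj χ(k)` for a unitary character. [folklore] -/
private theorem coe_map_inv (χ : PontryaginDual K) (k : K) :
    (((χ k⁻¹ : Circle)) : ℂ) = conj (((χ k : Circle)) : ℂ) := by
  rw [map_inv, Circle.coe_inv_eq_conj]

omit [IsTopologicalGroup K] [CompactSpace K] [T2Space K] [MeasurableSpace K] [BorelSpace K] [CompleteSpace E] in
include hρ in
/-- Continuity of the averaging integrand `k ↦ χ(k) • ρ(k) v` (the vector-valued functions whose invariant integral
Bröcker–tom Dieck III (5.1) forms). [cite: BrockerTomDieck1985, III (5.1)] -/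
theorem continuous_character_smul_apply (χ : PontryaginDual K) (v : E) :
    Continuous fun k => (((χ k : Circle)) : ℂ) • ρ k v :=
  (continuous_subtype_val.comp (map_continuous χ)).smul (hρ v)

omit [IsTopologicalGroup K] [T2Space K] [CompleteSpace E] [μ.IsOpenPosMeasure] in
include hρ in
/-- Bochner integrability of the averaging integrand for a strongly continuous representation and a continuous
character on a compact group (finite measure) — the invariant integral of a continuous vector-valued function,
Bröcker–tom Dieck III (5.1). [cite: BrockerTomDieck1985, III (5.1)] -/
theorem integrable_character_smul_apply (χ : PontryaginDual K) (v : E) :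
    Integrable (fun k => (((χ k : Circle)) : ℂ) • ρ k v) μ :=
  (continuous_character_smul_apply ρ hρ χ v).integrable_of_hasCompactSupport (HasCompactSupport.of_compactSpace _)

include hρ in
/-- **Isotypic averages detect continuous linear functionals.**  For a strongly continuous representation
`ρ : K →* (E →L[ℂ] E)` of a compact Hausdorff abelian group on a complex Banach space, a finite Borel measure `μ`
charging open sets, and a continuous linear functional `Λ` with `Λ v ≠ 0`, some continuous unitary character `χ` of
`K` has `Λ (∫ χ(k) • ρ(k) v dμ(k)) ≠ 0` — the continuous function `k ↦ Λ(ρ(k) v)` is non-zero (at `k = 1`), hence has a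
non-zero Fourier coefficient (Pontryagin–van Kampen, tree `exists_integral_mul_character_ne_zero`), and `Λ` passes
under the integral. [cite: DeitmarEchterhoff2014, Prop. 3.5.2; BrockerTomDieck1985, III (5.10)] -/
theorem exists_character_apply_average_ne_zero (Λ : E →L[ℂ] ℂ) {v : E} (hv : Λ v ≠ 0) :
    ∃ χ : PontryaginDual K, Λ (∫ k, (((χ k : Circle)) : ℂ) • ρ k v ∂μ) ≠ 0 := by
  let g : C(K, ℂ) := ⟨fun k => Λ (ρ k v), Λ.continuous.comp (hρ v)⟩
  have hg : ∀ k, g k = Λ (ρ k v) := fun _ => rfl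
  have hg0 : g ≠ 0 := by
    intro h
    apply hv
    have h1 : Λ (ρ 1 v) = 0 := by rw [← hg, h]; rfl
    rw [map_one] at h1
    exact h1
  obtain ⟨χ, hχ⟩ := exists_integral_mul_character_ne_zero μ g hg0
  refine ⟨χ, ?_⟩
  have hfun : (fun k => Λ ((((χ k : Circle)) : ℂ) • ρ k v)) = fun k => g k * (((χ k : Circle)) : ℂ) := by
    funext k
    rw [map_smul, smul_eq_mul, mul_comm, hg]
  rwa [← Λ.integral_comp_comm (integrable_character_smul_apply μ ρ hρ χ v), hfun]

include hρ in
/-- **A non-zero vector has a non-zero isotypic average**: `v ≠ 0 ⇒ ∫ χ(k) • ρ(k) v dμ(k) ≠ 0` for some continuous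
unitary character `χ` (Hahn–Banach `exists_dual_vector` supplies a functional with `Λ v = ‖v‖ ≠ 0`).
[cite: BrockerTomDieck1985, III (5.10); DeitmarEchterhoff2014, Prop. 3.5.2] -/
theorem exists_character_average_ne_zero {v : E} (hv : v ≠ 0) :
    ∃ χ : PontryaginDual K, ∫ k, (((χ k : Circle)) : ℂ) • ρ k v ∂μ ≠ 0 := by
  obtain ⟨Λ, -, hΛ⟩ := exists_dual_vector ℂ v (norm_ne_zero_iff.mpr hv)
  have hnorm : ‖Λ v‖ = ‖v‖ := by rw [hΛ]; simp
  have hΛ0 : Λ v ≠ 0 := fun h0 => by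
    rw [h0, norm_zero] at hnorm
    exact hv (norm_eq_zero.mp hnorm.symm)
  obtain ⟨χ, hχ⟩ := exists_character_apply_average_ne_zero μ ρ hρ Λ hΛ0
  exact ⟨χ, fun h => hχ (by rw [h, map_zero])⟩

include hρ in
/-- **Completeness of the isotypic decomposition** (compact abelian `K`, Banach `E`): a vector all of whose isotypic
averages `∫ χ(k) • ρ(k) v dμ(k)` vanish is zero. [cite: BrockerTomDieck1985, III (5.10)] -/
theorem eq_zero_of_forall_average_eq_zero {v : E}
    (h : ∀ χ : PontryaginDual K, ∫ k, (((χ k : Circle)) : ℂ) • ρ k v ∂μ = 0) : v = 0 := by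
  by_contra hv
  obtain ⟨χ, hχ⟩ := exists_character_average_ne_zero μ ρ hρ hv
  exact hχ (h χ)

omit [T2Space K] [μ.IsOpenPosMeasure] in
include hρ in
/-- **The average is `χ̄`-isotypic**: `ρ g (∫ χ(k) • ρ(k) v dμ) = conj χ(g) • ∫ χ(k) • ρ(k) v dμ` for a left-invariant
`μ` (the bounded operator `ρ g` passes under the integral, `ρ g ∘ ρ k = ρ (g k)`, and `k ↦ g k` preserves `μ`;
Bröcker–tom Dieck III Lemma (5.5), the tree's `Isotypic.apply_proj` for bounded instead of isometric operators).
[cite: BrockerTomDieck1985, III (5.5)] -/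
theorem apply_average [μ.IsMulLeftInvariant] (χ : PontryaginDual K) (g : K) (v : E) :
    ρ g (∫ k, (((χ k : Circle)) : ℂ) • ρ k v ∂μ) =
      conj ((((χ g : Circle)) : ℂ)) • ∫ k, (((χ k : Circle)) : ℂ) • ρ k v ∂μ := by
  rw [← (ρ g).integral_comp_comm (integrable_character_smul_apply μ ρ hρ χ v)]
  have h1 : (fun k => ρ g ((((χ k : Circle)) : ℂ) • ρ k v)) =
      fun k => (fun k' => (((χ (g⁻¹ * k') : Circle)) : ℂ) • ρ k' v) (g * k) := by
    funext k
    show ρ g ((((χ k : Circle)) : ℂ) • ρ k v) = (((χ (g⁻¹ * (g * k)) : Circle)) : ℂ) • ρ (g * k) v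
    rw [inv_mul_cancel_left, map_smul, map_mul]
    rfl
  rw [h1, integral_mul_left_eq_self (fun k' => (((χ (g⁻¹ * k') : Circle)) : ℂ) • ρ k' v) g]
  have h2 : (fun k' => (((χ (g⁻¹ * k') : Circle)) : ℂ) • ρ k' v) =
      fun k' => conj ((((χ g : Circle)) : ℂ)) • ((((χ k' : Circle)) : ℂ) • ρ k' v) := by
    funext k'
    rw [map_mul, Circle.coe_mul, coe_map_inv, smul_smul]
  rw [h2, integral_smul]

include hρ in
/-- **Bröcker–tom Dieck III (5.10) (iii), Banach form, compact abelian `K`: every vector is a norm limit of finite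
linear combinations of ITS OWN isotypic averages** — `v ∈ closure (span_ℂ {∫ χ(k) • ρ(k) v dμ(k) : χ ∈ K̂})` for a
strongly continuous representation `ρ` of a compact Hausdorff abelian group on a complex Banach space and a finite Borel
measure `μ` charging open sets.  Proof: if `v` were outside the closure `F̄` of that span, the class of `v` in the
seminormed quotient `E ⧸ F` has non-zero norm, so Hahn–Banach (`exists_dual_vector`) gives a continuous functional `Λ`
vanishing on `F` with `Λ v ≠ 0` — contradicting `exists_character_apply_average_ne_zero`, which produces an average
(an element of `F`) on which `Λ` is non-zero. [cite: BrockerTomDieck1985, III (5.10)] -/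
theorem mem_closure_span_range_average (v : E) :
    v ∈ closure (Submodule.span ℂ (Set.range fun χ : PontryaginDual K => ∫ k, (((χ k : Circle)) : ℂ) • ρ k v ∂μ) :
      Set E) := by
  set F : Submodule ℂ E :=
    Submodule.span ℂ (Set.range fun χ : PontryaginDual K => ∫ k, (((χ k : Circle)) : ℂ) • ρ k v ∂μ) with hF
  by_contra hv
  -- the class of `v` in the seminormed quotient `E ⧸ F` has non-zero norm
  have hnorm : ‖F.mkQ v‖ ≠ 0 := fun h0 =>
    hv ((QuotientAddGroup.norm_mk_eq_zero_iff_mem_closure (S := F.toAddSubgroup) (m := v)).mp h0)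
  obtain ⟨g, -, hg⟩ := exists_dual_vector ℂ (F.mkQ v) hnorm
  -- the functional `Λ = g ∘ (E → E ⧸ F)`
  let Q : E →L[ℂ] E ⧸ F :=
    F.mkQ.mkContinuous 1 fun x => by simpa only [one_mul, Submodule.mkQ_apply] using Submodule.Quotient.norm_mk_le F x
  have hQ : ∀ x, Q x = F.mkQ x := fun _ => rfl
  have hΛv : (g.comp Q) v ≠ 0 := by
    rw [ContinuousLinearMap.comp_apply, hQ, hg]
    exact RCLike.ofReal_ne_zero.mpr hnorm
  obtain ⟨χ, hχ⟩ := exists_character_apply_average_ne_zero μ ρ hρ (g.comp Q) hΛv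
  apply hχ
  have hmem : (∫ k, (((χ k : Circle)) : ℂ) • ρ k v ∂μ) ∈ F := Submodule.subset_span ⟨χ, rfl⟩
  rw [ContinuousLinearMap.comp_apply, hQ, Submodule.mkQ_apply, (Submodule.Quotient.mk_eq_zero F).mpr hmem, map_zero]

include hρ in
/-- … hence **the isotypic averages `∫ χ • ρ v dμ`, `χ ∈ K̂`, `v ∈ E`, span a DENSE subspace of `E`** (Banach form of the
completeness of the isotypic decomposition for compact abelian `K`). [cite: BrockerTomDieck1985, III (5.10)] -/
theorem topologicalClosure_span_range_average_eq_top :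
    (Submodule.span ℂ (Set.range fun p : PontryaginDual K × E =>
      ∫ k, (((p.1 k : Circle)) : ℂ) • ρ k p.2 ∂μ)).topologicalClosure = ⊤ := by
  refine Submodule.eq_top_iff'.mpr fun v => ?_
  rw [← SetLike.mem_coe, Submodule.topologicalClosure_coe]
  refine closure_mono (SetLike.coe_subset_coe.mpr (Submodule.span_mono ?_))
    (mem_closure_span_range_average μ ρ hρ v)
  rintro _ ⟨χ, rfl⟩
  exact ⟨(χ, v), rfl⟩

end AbelianIsotypic

/-! ## Bröcker–tom Dieck III (5.10) (iii) for compact abelian groups: the tree's `Isotypic.proj` -/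

namespace Isotypic

variable {K : Type*} [CommGroup K] [TopologicalSpace K] [IsTopologicalGroup K] [CompactSpace K] [T2Space K]
  [MeasurableSpace K] [BorelSpace K]
variable {E : Type*} [NormedAddCommGroup E] [InnerProductSpace ℂ E] [CompleteSpace E]
variable (μ : Measure K) [IsFiniteMeasure μ] [μ.IsOpenPosMeasure]
variable (ω : K →* (E ≃ₗᵢ[ℂ] E)) (hω : ∀ v, Continuous fun k => ω k v)

omit [TopologicalSpace K] [IsTopologicalGroup K] [CompactSpace K] [T2Space K] [MeasurableSpace K] [BorelSpace K]
  [CompleteSpace E] in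
/-- The bounded-operator representation underlying a unitary one (plumbing for `AbelianIsotypic`). [folklore] -/
private theorem exists_toCLM :
    ∃ ρ : K →* (E →L[ℂ] E), ∀ k v, ρ k v = ω k v :=
  ⟨{ toFun := fun k => ((ω k).toContinuousLinearEquiv : E →L[ℂ] E)
     map_one' := by ext v; simp
     map_mul' := fun a b => by ext v; simp }, fun _ _ => rfl⟩

include hω in
/-- **A non-zero vector of a strongly continuous unitary representation of a compact Hausdorff abelian group has a
non-zero isotypic component**: `v ≠ 0 ⇒ Isotypic.proj μ ω χ v ≠ 0` for some continuous unitary character `χ` (`μ`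
finite, charging open sets — e.g. the normalised Haar measure). [cite: BrockerTomDieck1985, III (5.10)] -/
theorem exists_proj_ne_zero {v : E} (hv : v ≠ 0) :
    ∃ χ : PontryaginDual K, proj μ ω (χ : K →* Circle) v ≠ 0 := by
  obtain ⟨ρ, hρω⟩ := exists_toCLM ω
  have hρ : ∀ v, Continuous fun k => ρ k v := fun v => by
    simp only [hρω]; exact hω v
  obtain ⟨χ, hχ⟩ := AbelianIsotypic.exists_character_average_ne_zero μ ρ hρ hv
  refine ⟨χ, ?_⟩
  have hfun : (fun k => ((((χ : K →* Circle) k : Circle)) : ℂ) • ω k v) =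
      fun k => (((χ k : Circle)) : ℂ) • ρ k v := funext fun k => by rw [hρω]; rfl
  rw [proj_def, hfun]
  exact hχ

include hω in
/-- **Bröcker–tom Dieck III (5.10) (iii), compact abelian case**: a vector of a strongly continuous unitary
representation all of whose isotypic projections `Isotypic.proj μ ω χ v` vanish is zero — `E` is the closed span
(indeed the Hilbert sum, by `Isotypic.inner_proj_comm` / `proj_proj`) of its isotypic subspaces `isoSub ω χ`.
[cite: BrockerTomDieck1985, III (5.10)] -/
theorem eq_zero_of_forall_proj_eq_zero {v : E} (h : ∀ χ : PontryaginDual K, proj μ ω (χ : K →* Circle) v = 0) :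
    v = 0 := by
  by_contra hv
  obtain ⟨χ, hχ⟩ := exists_proj_ne_zero μ ω hω hv
  exact hχ (h χ)

/-! ### Density of the isotypic decomposition (Hilbert-space form of (5.10) (iii)) -/

omit [T2Space K] [IsFiniteMeasure μ] [μ.IsOpenPosMeasure] in
include hω in
/-- `⟪P_χ w, w⟫ = ‖P_χ w‖²` for the self-adjoint idempotent average `P_χ = Isotypic.proj μ ω χ` (`μ` a left- and
inversion-invariant probability measure, e.g. the normalised Haar measure). [cite: BrockerTomDieck1985, III (5.10)] -/
theorem inner_proj_self_eq [IsProbabilityMeasure μ] [μ.IsMulLeftInvariant] [μ.IsInvInvariant] (χ : PontryaginDual K)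
    (w : E) :
    inner ℂ (proj μ ω (χ : K →* Circle) w) w =
      inner ℂ (proj μ ω (χ : K →* Circle) w) (proj μ ω (χ : K →* Circle) w) := by
  have hχ : Continuous (χ : K →* Circle) := map_continuous χ
  conv_lhs => rw [← proj_proj μ ω (χ : K →* Circle) w]
  exact inner_proj_comm μ ω (χ : K →* Circle) hω hχ _ _

include hω in
/-- **The orthogonal complement of the span of the isotypic subspaces is trivial**: for a strongly continuous unitary
representation of a compact Hausdorff abelian group on a Hilbert space and a left- and inversion-invariant probability
measure `μ` charging open sets (the normalised Haar measure), `(⨆_χ isoSub ω χ)ᗮ = ⊥` — a vector orthogonal to every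
isotypic subspace is orthogonal to its own projections `P_χ w ∈ isoSub ω χ`, so `‖P_χ w‖² = ⟪P_χ w, w⟫ = 0` for all
`χ`, hence `w = 0` by `eq_zero_of_forall_proj_eq_zero`. [cite: BrockerTomDieck1985, III (5.10)] -/
theorem orthogonal_iSup_isoSub_eq_bot [IsProbabilityMeasure μ] [μ.IsMulLeftInvariant] [μ.IsInvInvariant] :
    (⨆ χ : PontryaginDual K, isoSub ω (χ : K →* Circle))ᗮ = ⊥ := by
  rw [Submodule.eq_bot_iff]
  intro w hw
  rw [Submodule.mem_orthogonal] at hw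
  refine eq_zero_of_forall_proj_eq_zero μ ω hω fun χ => ?_
  have hmem : proj μ ω (χ : K →* Circle) w ∈ ⨆ χ : PontryaginDual K, isoSub ω (χ : K →* Circle) :=
    Submodule.mem_iSup_of_mem χ (proj_mem μ ω _ w)
  have h0 := hw _ hmem
  rw [inner_proj_self_eq μ ω hω χ w] at h0
  exact inner_self_eq_zero.mp h0

include hω in
/-- **Bröcker–tom Dieck III (5.10) (iii) for compact abelian groups, Hilbert-space form: the isotypic subspaces
`isoSub ω χ`, `χ ∈ K̂`, span a DENSE subspace** — `(⨆_χ isoSub ω χ).topologicalClosure = ⊤`: every vector of a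
strongly continuous unitary representation of a compact Hausdorff abelian group is a norm limit of finite sums of
isotypic vectors (`μ` the normalised Haar measure or any left- and inversion-invariant probability measure charging
open sets). [cite: BrockerTomDieck1985, III (5.10)] -/
theorem topologicalClosure_iSup_isoSub_eq_top [IsProbabilityMeasure μ] [μ.IsMulLeftInvariant] [μ.IsInvInvariant] :
    (⨆ χ : PontryaginDual K, isoSub ω (χ : K →* Circle)).topologicalClosure = ⊤ := by
  rw [Submodule.topologicalClosure_eq_top_iff]
  exact orthogonal_iSup_isoSub_eq_bot μ ω hω

include hω in
/-- … pointwise: every `v` lies in the closure of the span of the isotypic subspaces.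
[cite: BrockerTomDieck1985, III (5.10)] -/
theorem mem_closure_iSup_isoSub [IsProbabilityMeasure μ] [μ.IsMulLeftInvariant] [μ.IsInvInvariant] (v : E) :
    v ∈ closure ((⨆ χ : PontryaginDual K, isoSub ω (χ : K →* Circle) : Submodule ℂ E) : Set E) := by
  have h := topologicalClosure_iSup_isoSub_eq_top μ ω hω
  have hv : v ∈ (⨆ χ : PontryaginDual K, isoSub ω (χ : K →* Circle)).topologicalClosure := by
    rw [h]
    exact Submodule.mem_top
  exact hv

end Isotypic

end Literature.RepresentationTheory.CompactGroups

end
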